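import Literature.IUT.HodgeTheaters.GoodLocalFrobenioidOfGaloisSplitFromFConj
import Literature.AnabelianGeometry.EtaleTheta.SettingCompactObstruction
import HarnessLib

/-!
# The local group `Π_v̲` at a GOOD place is compact; no finite-index subgroup of a tempered `Π^tp_X` is

Mochizuki, *Inter-universal Teichmüller theory I*, kurims manuscript (May 2020), Def. 3.1 (e)(f) p. 63
[claim: Mochizuki2012, status: disputed]: "(f) … if `v̲ ∈ V̲^good`, then we shall write `Π_v̲ := Π_{X̲→_v̲}`" — the
PROFINITE étale fundamental group of the base-changed orbicurve (tempered fundamental groups enter only at `v̲ ∈ V̲^bad`,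
Def. 3.1 (e)); Example 3.3 (iii) (e) p. 79 cites "[AbsTopIII], Proposition 3.2, (iii)", i.e. [AbsTopIII] Thm. 1.9 /
Cor. 1.10 for the PROFINITE `Π_{X̲→_v̲}` of strictly Belyi type.  Nothing of the series is asserted; no side is taken on
[IUTchIII] Cor. 3.12.

PROOF-ONLY file (abc-iut cell, seat abc-iut-L5-t16 gen 8; sub-DAG SUBDAG-IUTchI-Ex33-Ex34 row E33iii/e, residual (E2-b)),
no definitions.  A KERNEL CERTIFICATE about the SHAPE of the remaining «merge map» for the (E2) binder of [IUTchI] Ex. 3.3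
(iii) (e): abc-iut-L5-t2's local group `Π_v̲ := D.PiLoc D.PiXarrow (localToGF F k ι)` of the Def. 3.1 datum at a good
nonarchimedean `v̲` (closed in the profinite `Π_{C_F} × Gal(k̄/k)`, hence COMPACT given the openness `hX` of Def. 3.1 (f):
abc-iut-w5-d096's `InitialThetaData.compactSpace_PiLoc`) admits NO isomorphism of topological groups onto a subgroup
of finite index `H` of the tempered group `Π^tp_X` of an [EtTh] §1 setting (abc-iut-L2's interface `ThetaSetting`:
`toZ : Π^tp_X ↠ ℤ` surjective with open kernel, [EtTh] §1 p. 12 "a natural surjection `Π^tp_X ↠ Z`"): `toZ(H)` has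
finite index in `ℤ`, hence is infinite, while an open-kernel homomorphism out of a compact group has finite image
(`not_compactSpace_of_finiteIndex_of_surjective_int`, `ThetaSettingLocal.not_compactSpace_of_finiteIndex` — the
finite-index refinement of abc-iut-w5-d243's `ThetaSetting.not_compactSpace_piTemp` (`SettingCompactObstruction.lean`) —,
`InitialThetaData.isEmpty_continuousMulEquiv_piLoc_thetaSetting` / `…_piTemp`).  CONSEQUENCE for the cell's bookkeeping (abc-iut-L5-lead
RULINGS #94 (1) / (Q2) 22:27:37Z, residual (E2-b) «identification of `Π_v̲` with an open finite-index `H ≤ Π^tp_X` of the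
setting + aug compatibility»): that identification is VACUOUS as a `≃ₜ*`; the anabelian input print cites at a GOOD
`v̲` is the PROFINITE [AbsTopIII] Cor. 1.10 (iii) for `X̲→_v̲`, whose Galois-side conjugacy shape
«`∀ φ ∃ τ ∈ G_{ℚ_p} ∀ g, aug(φ g) = τ · aug(g) · τ⁻¹`» is consumed VERBATIM (with `τ : GQp p` literally) by
`InitialThetaData.splitFromF_goodLocalFrobenioidOfEmb_of_conj_autCongr` (`GoodLocalFrobenioidOfGaloisSplitFromFConj.lean`)
— no tempered group and no `ThetaSetting` is involved at `v̲ ∈ V̲^good`.  Pure topology/group theory over Mathlib and the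
tree's interfaces; typed ≠ proved; nothing here asserts or refutes any statement of [IUTchI] / [EtTh] / [AbsTopIII].
-/

namespace Literature.IUT.HodgeTheaters

/-! ### §1 A group mapping onto `ℤ` with open kernel has no compact subgroup of finite index -/

/-- **A topological group with a homomorphism ONTO `ℤ` whose kernel is open has no compact subgroup of finite index**:
the image of a finite-index subgroup `H` has finite index in `ℤ`, hence is infinite; but the kernel of `f|_H` is an
open subgroup of the compact group `H`, so `f(H) ≅ H / (H ∩ Ker f)` is finite. [cite: MochizukiEtTh2009, §1 p.12] -/
theorem not_compactSpace_of_finiteIndex_of_surjective_int {G : Type*} [Group G] [TopologicalSpace G]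
    [IsTopologicalGroup G] (f : G →* Multiplicative ℤ) (hf : Function.Surjective f) (hker : IsOpen (f.ker : Set G))
    (H : Subgroup G) [H.FiniteIndex] : ¬ CompactSpace H := by
  intro hH
  -- `f(H)` is finite: the kernel of `f|_H` is open in the compact group `H`
  let fH : H →* Multiplicative ℤ := f.comp H.subtype
  have hKopen : IsOpen (fH.ker : Set H) := by
    have hset : (fH.ker : Set H) = ((↑) : H → G) ⁻¹' (f.ker : Set G) := by
      ext x
      simp only [SetLike.mem_coe, MonoidHom.mem_ker, Set.mem_preimage, fH, MonoidHom.coe_comp, Function.comp_apply,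
        Subgroup.coe_subtype]
    rw [hset]
    exact hker.preimage continuous_subtype_val
  haveI : Finite (H ⧸ fH.ker) := Subgroup.quotient_finite_of_isOpen fH.ker hKopen
  haveI hfin : Finite fH.range := Finite.of_equiv _ (QuotientGroup.quotientKerEquivRange fH).toEquiv
  have hrange : fH.range = H.map f := by
    rw [MonoidHom.range_comp, Subgroup.range_subtype]
  haveI : Finite (H.map f) := hrange ▸ hfin
  -- `f(H)` has finite index in `ℤ`, hence is infinite
  have hidx : (H.map f).index ≠ 0 := by
    intro h0
    have hd := Subgroup.index_map_dvd (H := H) hf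
    rw [h0, zero_dvd_iff] at hd
    exact Subgroup.FiniteIndex.index_ne_zero hd
  have hcard : Nat.card (H.map f) = 0 := by
    have h := (H.map f).index_mul_card
    rw [Nat.card_eq_zero_of_infinite (α := Multiplicative ℤ)] at h
    exact (mul_eq_zero.mp h).resolve_left hidx
  exact (Nat.card_pos (α := H.map f)).ne' hcard

/-! ### §2 At an [EtTh] §1 setting: no finite-index subgroup of `Π^tp_X` is compact -/

namespace ThetaSettingLocal

open Literature.AnabelianGeometry.EtaleTheta Literature.AnabelianGeometry.SemiGraphs

variable {p : ℕ} [Fact p.Prime]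

/-- **No subgroup of finite index of the tempered group `Π^tp_X` of an [EtTh] §1 setting is compact** (`toZ : Π^tp_X ↠ ℤ`
surjective with open kernel, [EtTh] §1 p. 12; in particular `Π^tp_X` itself and every `Π^tp_{X_H}` for a connected finite
étale covering `X_H → X` are non-compact). [cite: MochizukiEtTh2009, §1 p.12] -/
theorem not_compactSpace_of_finiteIndex (S : ThetaSetting p) (H : Subgroup S.PiTemp) [H.FiniteIndex] :
    ¬ CompactSpace H :=
  not_compactSpace_of_finiteIndex_of_surjective_int S.toZ S.toZ_surjective S.isOpen_ker_toZ H

/-- Hence **no compact topological group is isomorphic (as a topological group) to a finite-index subgroup of `Π^tp_X`**.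
[cite: MochizukiEtTh2009, §1 p.12] -/
theorem isEmpty_continuousMulEquiv_of_compactSpace {P : Type*} [Group P] [TopologicalSpace P] [CompactSpace P]
    (S : ThetaSetting p) (H : Subgroup S.PiTemp) [H.FiniteIndex] : IsEmpty (P ≃ₜ* H) :=
  ⟨fun ψ => not_compactSpace_of_finiteIndex S H ψ.toHomeomorph.compactSpace⟩

end ThetaSettingLocal

/-! ### §3 The Def. 3.1 datum: `Π_v̲` at a good place is compact, so the tempered «merge map» shape is vacuous -/

section Datum

open Literature.AnabelianGeometry.EtaleTheta Literature.AnabelianGeometry.SemiGraphs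
open Literature.AnabelianGeometry.AbsoluteAnabelian

universe v w

variable {F : Type v} {K : Type w} {Fbar : Type} [Field F] [NumberField F] [Field K] [NumberField K]
  [Algebra F K] [Field Fbar] [Algebra F Fbar] [Algebra K Fbar] [IsScalarTower F K Fbar] [Normal K Fbar]
  {E : WeierstrassCurve F} [E.IsElliptic] {l : ℕ} {Pb : BadPlacePredicates K}
  (D : InitialThetaData F K Fbar E l Pb) (p : ℕ) [Fact p.Prime]
  (k : Type) [NontriviallyNormedField k] [CompleteSpace k] [IsUltrametricDist k] [NormedAlgebra ℚ_[p] k]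
  [FiniteDimensional ℚ_[p] k] [Algebra K k]

namespace InitialThetaData

omit [CompleteSpace k] [IsUltrametricDist k] [FiniteDimensional ℚ_[p] k] in
/-- **`Π_v̲ := Π_{X̲→_K} ×_{G_K} Gal(k̄/k)` at a good nonarchimedean `v̲` (Def. 3.1 (e)(f), `K_v̲ = k`) admits NO
isomorphism of topological groups onto a finite-index subgroup `H` of the tempered group `Π^tp_X` of ANY [EtTh] §1
setting**: `Π_v̲` is compact (profinite; abc-iut-w5-d096's `compactSpace_PiLoc` from the openness `hX` of Def. 3.1 (f)),
`H` is not (§2).  So the (E2) input of Ex. 3.3 (iii) (e) at `v̲ ∈ V̲^good` cannot be drawn from a TEMPERED statement over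
a `ThetaSetting` by transport along such an isomorphism; print's input there is the PROFINITE [AbsTopIII] Cor. 1.10 (iii)
for `X̲→_v̲`, consumed in conjugacy shape by `splitFromF_goodLocalFrobenioidOfEmb_of_conj_autCongr`.
([IUTchI] Def 3.1 (f) p.63) [claim: Mochizuki2012, status: disputed] -/
theorem isEmpty_continuousMulEquiv_piLoc_thetaSetting (ι : Fbar →ₐ[K] AlgebraicClosure k)
    (hX : IsOpen (D.PiXarrow : Set D.PiC)) (S : ThetaSetting p) (H : Subgroup S.PiTemp) [H.FiniteIndex] :
    IsEmpty (D.PiLoc D.PiXarrow (localToGF F k ι) ≃ₜ* H) := by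
  haveI := GaloisValDatum.charZero p k
  haveI : CompactSpace (D.PiLoc D.PiXarrow (localToGF F k ι)) :=
    D.compactSpace_PiLoc D.PiXarrow (localToGF F k ι) hX (continuous_localToGF F k ι)
  exact ThetaSettingLocal.isEmpty_continuousMulEquiv_of_compactSpace S H

omit [CompleteSpace k] [IsUltrametricDist k] [FiniteDimensional ℚ_[p] k] in
/-- The same for the full tempered group `Π^tp_X` (index `1`). ([IUTchI] Def 3.1 (f) p.63) [claim: Mochizuki2012, status: disputed] -/
theorem isEmpty_continuousMulEquiv_piLoc_piTemp (ι : Fbar →ₐ[K] AlgebraicClosure k)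
    (hX : IsOpen (D.PiXarrow : Set D.PiC)) (S : ThetaSetting p) :
    IsEmpty (D.PiLoc D.PiXarrow (localToGF F k ι) ≃ₜ* S.PiTemp) := by
  haveI := GaloisValDatum.charZero p k
  haveI : CompactSpace (D.PiLoc D.PiXarrow (localToGF F k ι)) :=
    D.compactSpace_PiLoc D.PiXarrow (localToGF F k ι) hX (continuous_localToGF F k ι)
  exact ⟨fun ψ => S.not_compactSpace_piTemp ψ.symm.toHomeomorph.symm.compactSpace⟩

end InitialThetaData

end Datum

end Literature.IUT.HodgeTheaters
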